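import Literature.RingTheory.LocalCohomology.CechPolynomialShift
import Literature.RingTheory.LocalCohomology.TwoElementSaturation
import Mathlib.Algebra.Polynomial.Module.Basic
import Mathlib.RingTheory.QuotSMulTop
import HarnessLib

/-!
# The inductive step of Kawasaki's theorem on Cohen–Macaulay blow-ups, chart form

Topic `Literature/RingTheory/LocalCohomology`, sequel of `CechPolynomialShift.lean` and
`TwoElementSaturation.lean`. This file proves the module-theoretic heart of the inductive step in
Česnavičius's proof of Kawasaki's theorem (Česnavičius 2021, Thm. 3.13 = Kawasaki 2000, Thm. 4.1:
the blow-up of `M` along `∏ᵢ (r_1,…,r_i)` is Cohen–Macaulay), in the vanishing form of Čech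
local cohomology and without spectral sequences.

**Setting.** `A` is a commutative ring, `ιb : N → N[1/b] =: Nb` a localisation of an `A`-module at
the powers of `b`, and `a ∈ A`. On `Nb` the element `b` is invertible, so `θ := a/b` is an
endomorphism of `Nb` and `Nb` becomes an `A[T]`-module `Nθ` (`T ↦ θ`, `Module.AEval'`). The
**chart module** is the `A[T]`-submodule `P := A[T] · N = Σ_k (a/b)^k N ⊆ Nb` (`chartP`); in the
application `P` is the module of sections of the strict transform of `M` on the next affine chart
`A[a/b]` of the blow-up.

**The step** (`cechVanishBelow_chartP`): let `a, b ∈ √(y)` for a family `y` of elements of `A`,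
let `φ : Nb/N → W` be `A`-linear into a module `W` on which `a` acts bijectively, such that `a` and
`b` kill `ker φ`, and suppose `Hʲ_{(y)}(ker φ) = 0` and `Hʲ_{(y)}(W / im φ) = 0` for `j < n`. Then
for every monic `f ∈ A[T]`,

`Hʲ_{(f, y)}(P) = 0` for `j < n + 2`.

(In the application, `W = N[1/ab]/sat_a`, `ker φ ≅ H¹_{(a,b)}(N)` and `W / im φ ≅ H²_{(a,b)}(N)`,
see `TwoElementSaturation.lean`; `(f, y)` generates a maximal ideal of `A[T]` over one of `A`.)

**Proof** (loc. cit., (punch-1)–(punch-5) and (bam-1)–(bam-4), recast): put `u := bT - a ∈ A[T]`,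
`V := Nb/N`, `X := V[T]`, `Y := W[T]`, `Γ := ker(φ[T]) = (ker φ)[T]`, `Z := im(φ[T]) ⊆ Y`.
* `Nθ ≅ Nb[T]/u Nb[T]` (`ker_Phi`: `u` kills `Nθ`, and an element of `Nb[T]` killed in `Nθ` is
  divisible by `u`, by induction on the degree using that `b` is invertible on `Nb`), whence
  `Nθ/P ≅ X/uX` (`quotEquiv`), and `H_{(f,y)}(Nθ) = 0` in all degrees (`b` acts bijectively), so
  `Hʲ(P) = 0` for `j < n + 2` iff `Hʲ(X/uX) = 0` for `j < n + 1`;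
* `0 → Γ → X/uX → (X/Γ)/u(X/Γ) → 0` is exact (`u Γ = 0` since `a, b` kill `ker φ`; `Γ ∩ uX = 0`
  since `u` is injective on `Y`, `a` being injective on `W`), and `(X/Γ)/u ≅ Z/uZ`;
* `Hʲ(Γ) = Hʲ((ker φ)[T]) = 0` for `j < n + 1` by the polynomial shift (`CechPolynomialShift`);
* `Hʲ(Z/uZ) = 0` for `j < n + 1` from `Hʲ(Z) = 0` for `j < n + 2` (`u` is `Z`-regular), which
  follows from `0 → Z → Y → Y/Z → 0`, `H(Y) = 0` in all degrees (`a` bijective on `W`) and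
  `Y/Z ≅ (W / im φ)[T]`, `Hʲ((W / im φ)[T]) = 0` for `j < n + 1` by the polynomial shift.

Finally `cechVanishBelow_span_of_chart` transports the statement to any `A[T]`-module `Ω'`
receiving `Nb` injectively and compatibly (`T κ(b v) = κ(a v)`), e.g. `Ω' = M[1/gb]` with its
module structure over the next chart ring: `Hʲ_{(f,y)}(A[T] · κ(N)) = 0` for `j < n + 2`.

Everything is proved; no named facts.

## References

* [Cesnavicius2021] K. Česnavičius, *Macaulayfication of Noetherian schemes*, Duke Math. J. 170
  (2021), proof of Thm. 3.13 ((punch-1)–(punch-5), (bam-1)–(bam-4)).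
* [Kawasaki2000] T. Kawasaki, *On Macaulayfication of Noetherian schemes*, Trans. AMS 352 (2000),
  Thm. 4.1, Lemmas 4.3–4.5.
-/

noncomputable section

universe u

namespace Literature.RingTheory.LocalCohomology

open Polynomial PolynomialModule Pointwise

variable {A : Type u} [CommRing A]

/-! ## Polynomial modules: `A[T]`-linear functoriality and exactness -/

section PolyMap

variable {U V W : Type u} [AddCommGroup U] [Module A U] [AddCommGroup V] [Module A V]
  [AddCommGroup W] [Module A W]

/-- Coefficients are `A`-linear. [folklore] -/
theorem PolynomialModule.coeff_smul_of_tower (r : A) (q : PolynomialModule A V) (k : ℕ) :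
    (r • q).coeff k = r • q.coeff k := rfl

/-- Coefficients of a difference. [folklore] -/
theorem PolynomialModule.coeff_sub (q q' : PolynomialModule A V) (k : ℕ) :
    (q - q').coeff k = q.coeff k - q'.coeff k := rfl

/-- `C r` acts as `r`. [folklore] -/
theorem PolynomialModule.C_smul_eq (r : A) (q : PolynomialModule A V) : (C r : A[X]) • q = r • q := by
  rw [Polynomial.C_eq_algebraMap, algebraMap_smul]

/-- Coefficients of `T • q`. [folklore] -/
theorem PolynomialModule.coeff_X_smul_succ (q : PolynomialModule A V) (k : ℕ) :
    ((X : A[X]) • q).coeff (k + 1) = q.coeff k := by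
  rw [← Polynomial.monomial_one_one_eq_X, PolynomialModule.monomial_smul_apply, if_pos (by omega),
    one_smul, Nat.add_sub_cancel]

/-- The constant coefficient of `T • q` vanishes. [folklore] -/
theorem PolynomialModule.coeff_X_smul_zero (q : PolynomialModule A V) :
    ((X : A[X]) • q).coeff 0 = 0 := by
  rw [← Polynomial.monomial_one_one_eq_X, PolynomialModule.monomial_smul_apply, if_neg (by omega)]

/-- Coefficients of `(bT - a) • q`, positive degrees. [folklore] -/
theorem PolynomialModule.coeff_u_smul_succ (a b : A) (q : PolynomialModule A V) (k : ℕ) :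
    ((C b * X - C a : A[X]) • q).coeff (k + 1) = b • q.coeff k - a • q.coeff (k + 1) := by
  rw [sub_smul, mul_smul, PolynomialModule.C_smul_eq, PolynomialModule.C_smul_eq,
    PolynomialModule.coeff_sub, PolynomialModule.coeff_smul_of_tower,
    PolynomialModule.coeff_smul_of_tower, PolynomialModule.coeff_X_smul_succ]

/-- The constant coefficient of `(bT - a) • q`. [folklore] -/
theorem PolynomialModule.coeff_u_smul_zero (a b : A) (q : PolynomialModule A V) :
    ((C b * X - C a : A[X]) • q).coeff 0 = -(a • q.coeff 0) := by
  rw [sub_smul, mul_smul, PolynomialModule.C_smul_eq, PolynomialModule.C_smul_eq,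
    PolynomialModule.coeff_sub, PolynomialModule.coeff_smul_of_tower,
    PolynomialModule.coeff_smul_of_tower, PolynomialModule.coeff_X_smul_zero, smul_zero, zero_sub]

/-- Coefficients of `map`. [folklore] -/
theorem PolynomialModule.coeff_map (φ : V →ₗ[A] W) (q : PolynomialModule A V) (k : ℕ) :
    (PolynomialModule.map A φ q).coeff k = φ (q.coeff k) := rfl

variable (A) in
/-- **`φ[T] : V[T] → W[T]` as an `A[T]`-linear map** (Mathlib's `PolynomialModule.map` is only
bundled `A`-linearly). [folklore] -/
def PolynomialModule.mapₗ (φ : V →ₗ[A] W) : PolynomialModule A V →ₗ[A[X]] PolynomialModule A W where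
  toFun := PolynomialModule.map A φ
  map_add' := map_add _
  map_smul' p q := by
    rw [RingHom.id_apply, PolynomialModule.map_smul, Algebra.algebraMap_self, Polynomial.map_id]

/-- `mapₗ` is `map`. [folklore] -/
@[simp]
theorem PolynomialModule.mapₗ_apply (φ : V →ₗ[A] W) (q : PolynomialModule A V) :
    PolynomialModule.mapₗ A φ q = PolynomialModule.map A φ q := rfl

/-- Coefficients of `mapₗ`. [folklore] -/
theorem PolynomialModule.coeff_mapₗ (φ : V →ₗ[A] W) (q : PolynomialModule A V) (k : ℕ) :
    (PolynomialModule.mapₗ A φ q).coeff k = φ (q.coeff k) := rfl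

/-- `mapₗ` on monomials. [folklore] -/
theorem PolynomialModule.mapₗ_single (φ : V →ₗ[A] W) (k : ℕ) (v : V) :
    PolynomialModule.mapₗ A φ (PolynomialModule.single A k v) = PolynomialModule.single A k (φ v) :=
  PolynomialModule.map_single A φ k v

/-- `φ[T]` is injective if `φ` is. [folklore] -/
theorem PolynomialModule.mapₗ_injective {φ : V →ₗ[A] W} (h : Function.Injective φ) :
    Function.Injective (PolynomialModule.mapₗ A φ) := by
  intro q q' hq
  apply PolynomialModule.coeff_injective
  apply Finsupp.mapRange_injective φ (map_zero φ) h
  ext k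
  rw [Finsupp.mapRange_apply, Finsupp.mapRange_apply, ← PolynomialModule.coeff_mapₗ,
    ← PolynomialModule.coeff_mapₗ, hq]

/-- `φ[T]` is surjective if `φ` is. [folklore] -/
theorem PolynomialModule.mapₗ_surjective {φ : V →ₗ[A] W} (h : Function.Surjective φ) :
    Function.Surjective (PolynomialModule.mapₗ A φ) := by
  intro q
  obtain ⟨c, hc⟩ := Finsupp.mapRange_surjective φ (map_zero φ) h q.coeff
  refine ⟨PolynomialModule.ofCoeff A c, ?_⟩
  apply PolynomialModule.coeff_injective
  rw [← hc]
  ext k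
  rw [PolynomialModule.coeff_mapₗ, Finsupp.mapRange_apply]

/-- **`(-)[T]` is exact.** [folklore] -/
theorem PolynomialModule.mapₗ_exact {f : U →ₗ[A] V} {g : V →ₗ[A] W} (hfg : Function.Exact f g) :
    Function.Exact (PolynomialModule.mapₗ A f) (PolynomialModule.mapₗ A g) := by
  rw [LinearMap.exact_iff]
  apply le_antisymm
  · intro q hq
    rw [LinearMap.mem_ker] at hq
    have hk : ∀ k, q.coeff k ∈ LinearMap.range f := fun k => by
      rw [← hfg.linearMap_ker_eq, LinearMap.mem_ker, ← PolynomialModule.coeff_mapₗ, hq]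
      rfl
    have key : ∀ c : ℕ →₀ V, (∀ k, c k ∈ LinearMap.range f) →
        PolynomialModule.ofCoeff A c ∈ LinearMap.range (PolynomialModule.mapₗ A f) := by
      intro c
      induction c using Finsupp.induction with
      | zero => exact fun _ => by rw [PolynomialModule.ofCoeff_zero]; exact Submodule.zero_mem _
      | single_add i v c hi _ ih =>
        intro H
        have hci : c i = 0 := Finsupp.notMem_support_iff.mp hi
        have hv : v ∈ LinearMap.range f := by
          have := H i
          rwa [Finsupp.add_apply, Finsupp.single_eq_same, hci, add_zero] at this
        have hc : ∀ k, c k ∈ LinearMap.range f := fun k => by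
          by_cases hk : k = i
          · rw [hk, hci]
            exact Submodule.zero_mem _
          · have := H k
            rwa [Finsupp.add_apply, Finsupp.single_eq_of_ne hk, zero_add] at this
        obtain ⟨w, hw⟩ := hv
        rw [PolynomialModule.ofCoeff_add, PolynomialModule.ofCoeff_single]
        refine Submodule.add_mem _ ⟨PolynomialModule.single A i w, ?_⟩ (ih hc)
        rw [PolynomialModule.mapₗ_single, hw]
    have := key q.coeff hk
    rwa [PolynomialModule.ofCoeff_coeff] at this
  · rintro _ ⟨q, rfl⟩
    rw [LinearMap.mem_ker]
    apply PolynomialModule.coeff_injective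
    ext k
    rw [PolynomialModule.coeff_mapₗ, PolynomialModule.coeff_mapₗ, hfg.apply_apply_eq_zero]
    rfl

/-- `(ker φ)[T] ≅ ker (φ[T])`, `A[T]`-linearly. [folklore] -/
def PolynomialModule.kerEquiv (φ : V →ₗ[A] W) :
    PolynomialModule A (LinearMap.ker φ) ≃ₗ[A[X]] LinearMap.ker (PolynomialModule.mapₗ A φ) :=
  LinearEquiv.ofInjective (PolynomialModule.mapₗ A (LinearMap.ker φ).subtype)
      (PolynomialModule.mapₗ_injective (LinearMap.ker φ).injective_subtype) ≪≫ₗ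
    LinearEquiv.ofEq _ _
      (PolynomialModule.mapₗ_exact (LinearMap.exact_subtype_ker_map φ)).linearMap_ker_eq.symm

/-- `W[T] / im(φ[T]) ≅ (W / im φ)[T]`, `A[T]`-linearly. [folklore] -/
def PolynomialModule.cokerEquiv (φ : V →ₗ[A] W) :
    (PolynomialModule A W ⧸ LinearMap.range (PolynomialModule.mapₗ A φ)) ≃ₗ[A[X]]
      PolynomialModule A (W ⧸ LinearMap.range φ) :=
  (PolynomialModule.mapₗ_exact (LinearMap.exact_map_mkQ_range φ)).linearEquivOfSurjective
    (PolynomialModule.mapₗ_surjective (Submodule.mkQ_surjective _))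

/-- The action of `r ∈ A` on `V[T]` is `(r • id)[T]`. [folklore] -/
theorem PolynomialModule.smul_eq_mapₗ (r : A) (q : PolynomialModule A V) :
    r • q = PolynomialModule.mapₗ A (r • (LinearMap.id : V →ₗ[A] V)) q := by
  apply PolynomialModule.coeff_injective
  ext k
  rfl

/-- If `r` acts bijectively on `V`, then `C r` acts bijectively on `V[T]`. [folklore] -/
theorem PolynomialModule.bijective_C_smul {r : A} (h : Function.Bijective fun v : V => r • v) :
    Function.Bijective fun q : PolynomialModule A V => (C r : A[X]) • q := by
  have : (fun q : PolynomialModule A V => (C r : A[X]) • q) =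
      ⇑(PolynomialModule.mapₗ A (r • (LinearMap.id : V →ₗ[A] V))) := by
    funext q
    rw [PolynomialModule.C_smul_eq, PolynomialModule.smul_eq_mapₗ]
  rw [this]
  exact ⟨PolynomialModule.mapₗ_injective h.1, PolynomialModule.mapₗ_surjective h.2⟩

/-- **`bT - a` is a non-zero-divisor on `W[T]` as soon as `a` is injective on `W`** (triangular
recursion on the coefficients). [cite: Cesnavicius2021, proof of Thm. 3.13, (punch-2)] -/
theorem PolynomialModule.isSMulRegular_u {a : A} (b : A) (ha : Function.Injective fun w : W => a • w) :
    IsSMulRegular (PolynomialModule A W) (C b * X - C a : A[X]) := by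
  have key : ∀ q : PolynomialModule A W, (C b * X - C a : A[X]) • q = 0 → q = 0 := by
    intro q hq
    have hcoeff : ∀ k, q.coeff k = 0 := by
      intro k
      induction k with
      | zero =>
        apply ha
        have h0 := congrArg (fun p : PolynomialModule A W => p.coeff 0) hq
        simp only [PolynomialModule.coeff_u_smul_zero, PolynomialModule.coeff_zero,
          Finsupp.zero_apply, neg_eq_zero] at h0
        simp only [h0, smul_zero]
      | succ k ih =>
        apply ha
        have h1 := congrArg (fun p : PolynomialModule A W => p.coeff (k + 1)) hq
        simp only [PolynomialModule.coeff_u_smul_succ, PolynomialModule.coeff_zero,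
          Finsupp.zero_apply, ih, smul_zero, zero_sub, neg_eq_zero] at h1
        simp only [h1, smul_zero]
    apply PolynomialModule.coeff_injective
    ext k
    rw [hcoeff k]
    rfl
  intro q q' h
  rw [← sub_eq_zero]
  apply key
  rw [smul_sub, sub_eq_zero]
  exact h

end PolyMap

/-! ## The action map `L[T] → L` of an `A[T]`-module -/

section Action

variable (L : Type u) [AddCommGroup L] [Module A L] [Module A[X] L] [IsScalarTower A A[X] L]

variable (A) in
/-- **The action map** `L[T] → L`, `Σ_k l_k T^k ↦ Σ_k T^k • l_k`, `A[T]`-linear.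
[folklore] -/
def PolynomialModule.actionMap : PolynomialModule A L →ₗ[A[X]] L where
  toFun q := PolynomialModule.eval (X : A[X]) (PolynomialModule.map A[X] (LinearMap.id : L →ₗ[A] L) q)
  map_add' q q' := by simp only [map_add]
  map_smul' p q := by
    simp only [RingHom.id_apply]
    rw [PolynomialModule.map_smul, PolynomialModule.eval_smul, Polynomial.eval_map,
      Polynomial.algebraMap_eq, Polynomial.eval₂_C_X]

/-- The action map on monomials. [folklore] -/
theorem PolynomialModule.actionMap_single (k : ℕ) (l : L) :
    PolynomialModule.actionMap A L (PolynomialModule.single A k l) = (X : A[X]) ^ k • l := by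
  show PolynomialModule.eval (X : A[X]) (PolynomialModule.map A[X] LinearMap.id
    (PolynomialModule.single A k l)) = _
  rw [PolynomialModule.map_single, PolynomialModule.eval_single]
  rfl

end Action

/-! ## `N[1/b]` as an `A[T]`-module via `T ↦ a/b`, and the chart module `P = A[a/b]·N` -/

section Chart

variable {N Nb : Type u} [AddCommGroup N] [Module A N] [AddCommGroup Nb] [Module A Nb]
  (ιb : N →ₗ[A] Nb) (a b : A)

/-- `b` as a unit of `End(N[1/b])`. [folklore] -/
def bUnit [IsLocalizedModule (Submonoid.powers b) ιb] : (Module.End A Nb)ˣ :=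
  (IsLocalizedModule.map_units ιb (⟨b, 1, pow_one b⟩ : Submonoid.powers b)).unit

/-- `bUnit` acts as `b`. [folklore] -/
theorem bUnit_apply [IsLocalizedModule (Submonoid.powers b) ιb] (v : Nb) :
    (bUnit ιb b : Module.End A Nb) v = b • v := rfl

/-- `b • b⁻¹ v = v`. [folklore] -/
theorem b_smul_bUnit_inv [IsLocalizedModule (Submonoid.powers b) ιb] (v : Nb) :
    b • ((↑(bUnit ιb b)⁻¹ : Module.End A Nb) v) = v := by
  have : b • ((↑(bUnit ιb b)⁻¹ : Module.End A Nb) v) =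
      ((bUnit ιb b : Module.End A Nb) * ↑(bUnit ιb b)⁻¹) v := rfl
  rw [this, Units.mul_inv, Module.End.one_apply]

/-- `b⁻¹ (b • v) = v`. [folklore] -/
theorem bUnit_inv_b_smul [IsLocalizedModule (Submonoid.powers b) ιb] (v : Nb) :
    (↑(bUnit ιb b)⁻¹ : Module.End A Nb) (b • v) = v := by
  have : (↑(bUnit ιb b)⁻¹ : Module.End A Nb) (b • v) =
      ((↑(bUnit ιb b)⁻¹ : Module.End A Nb) * (bUnit ιb b : Module.End A Nb)) v := rfl
  rw [this, Units.inv_mul, Module.End.one_apply]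

/-- `b` acts bijectively on `N[1/b]`. [folklore] -/
theorem bijective_b_smul [IsLocalizedModule (Submonoid.powers b) ιb] :
    Function.Bijective fun v : Nb => b • v :=
  (Module.End.isUnit_iff _).mp (IsLocalizedModule.map_units ιb (⟨b, 1, pow_one b⟩ :
    Submonoid.powers b))

/-- **The endomorphism `θ = a/b` of `N[1/b]`.** [cite: Cesnavicius2021, proof of Thm. 3.13] -/
def theta [IsLocalizedModule (Submonoid.powers b) ιb] : Module.End A Nb :=
  (↑(bUnit ιb b)⁻¹ : Module.End A Nb) * (a • (LinearMap.id : Nb →ₗ[A] Nb))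

/-- Unfolding `θ`. [folklore] -/
theorem theta_apply [IsLocalizedModule (Submonoid.powers b) ιb] (v : Nb) :
    theta ιb a b v = (↑(bUnit ιb b)⁻¹ : Module.End A Nb) (a • v) := rfl

/-- `b • θ v = a • v`. [folklore] -/
theorem b_smul_theta [IsLocalizedModule (Submonoid.powers b) ιb] (v : Nb) :
    b • theta ιb a b v = a • v := by
  rw [theta_apply, b_smul_bUnit_inv]

/-- `θ (b • v) = a • v`. [folklore] -/
theorem theta_b_smul [IsLocalizedModule (Submonoid.powers b) ιb] (v : Nb) :
    theta ιb a b (b • v) = a • v := by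
  rw [theta_apply, smul_comm, bUnit_inv_b_smul]

/-- **`N[1/b]` as an `A[T]`-module, `T` acting as `θ = a/b`.**
[cite: Cesnavicius2021, proof of Thm. 3.13] -/
abbrev Nθ [IsLocalizedModule (Submonoid.powers b) ιb] : Type u := Module.AEval' (theta ιb a b)

/-- The tautological identification `N[1/b] ≃ Nθ`. [folklore] -/
abbrev toNθ [IsLocalizedModule (Submonoid.powers b) ιb] : Nb ≃ₗ[A] Nθ ιb a b :=
  Module.AEval'.of (theta ιb a b)

/-- `T • v = θ v` on `Nθ`. [folklore] -/
theorem X_smul_toNθ [IsLocalizedModule (Submonoid.powers b) ιb] (v : Nb) :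
    (X : A[X]) • toNθ ιb a b v = toNθ ιb a b (theta ιb a b v) :=
  Module.AEval.X_smul_of _ v

/-- `C r • m = r • m` on `Nθ`, through `toNθ`. [folklore] -/
theorem C_smul_toNθ [IsLocalizedModule (Submonoid.powers b) ιb] (r : A) (v : Nb) :
    (C r : A[X]) • toNθ ιb a b v = toNθ ιb a b (r • v) := by
  rw [Module.AEval.C_smul, LinearEquiv.map_smul]

/-- **`u = bT - a` kills `Nθ`.** [cite: Cesnavicius2021, proof of Thm. 3.13, (punch-1)] -/
theorem u_smul_Nθ [IsLocalizedModule (Submonoid.powers b) ιb] (m : Nθ ιb a b) :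
    (C b * X - C a : A[X]) • m = 0 := by
  obtain ⟨v, rfl⟩ := (toNθ ιb a b).surjective m
  rw [sub_smul, mul_smul, X_smul_toNθ, C_smul_toNθ, C_smul_toNθ, b_smul_theta, sub_self]

/-- `C b` acts bijectively on `Nθ`. [folklore] -/
theorem bijective_C_b_smul_Nθ [IsLocalizedModule (Submonoid.powers b) ιb] :
    Function.Bijective fun m : Nθ ιb a b => (C b : A[X]) • m := by
  have : (fun m : Nθ ιb a b => (C b : A[X]) • m) =
      toNθ ιb a b ∘ (fun v : Nb => b • v) ∘ (toNθ ιb a b).symm := by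
    funext m
    obtain ⟨v, rfl⟩ := (toNθ ιb a b).surjective m
    simp only [Function.comp_apply, LinearEquiv.symm_apply_apply, C_smul_toNθ]
  rw [this]
  exact (toNθ ιb a b).bijective.comp ((bijective_b_smul ιb b).comp (toNθ ιb a b).symm.bijective)

/-- **The chart module `P = A[a/b] · N ⊆ N[1/b]`** as an `A[T]`-submodule of `Nθ`: the
`A[T]`-span of the image of `N`. In the application this is the module of sections of the strict
transform on the chart `A[a/b]` of the blow-up along `(a, b)`.
[cite: Cesnavicius2021, proof of Thm. 3.13; Kawasaki2000, §4] -/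
def chartP [IsLocalizedModule (Submonoid.powers b) ιb] : Submodule A[X] (Nθ ιb a b) :=
  Submodule.span A[X] (Set.range (toNθ ιb a b ∘ ιb))

/-- `N ⊆ P`. [folklore] -/
theorem toNθ_mem_chartP [IsLocalizedModule (Submonoid.powers b) ιb] (x : N) :
    toNθ ιb a b (ιb x) ∈ chartP ιb a b :=
  Submodule.subset_span ⟨x, rfl⟩

/-! ### `Nθ ≅ Nb[T]/(bT - a)` -/

/-- **The presentation map `Φ : Nb[T] → Nθ`, `Σ v_k T^k ↦ Σ θ^k v_k`.**
[cite: Cesnavicius2021, proof of Thm. 3.13, (punch-1)] -/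
def Phi [IsLocalizedModule (Submonoid.powers b) ιb] : PolynomialModule A Nb →ₗ[A[X]] Nθ ιb a b :=
  PolynomialModule.actionMap A (Nθ ιb a b) ∘ₗ
    PolynomialModule.mapₗ A (toNθ ιb a b : Nb →ₗ[A] Nθ ιb a b)

/-- `Φ` on monomials. [folklore] -/
theorem Phi_single [IsLocalizedModule (Submonoid.powers b) ιb] (k : ℕ) (v : Nb) :
    Phi ιb a b (PolynomialModule.single A k v) = (X : A[X]) ^ k • toNθ ιb a b v := by
  rw [Phi, LinearMap.comp_apply, PolynomialModule.mapₗ_single, PolynomialModule.actionMap_single]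
  rfl

/-- `Φ` on constants. [folklore] -/
theorem Phi_single_zero [IsLocalizedModule (Submonoid.powers b) ιb] (v : Nb) :
    Phi ιb a b (PolynomialModule.single A 0 v) = toNθ ιb a b v := by
  rw [Phi_single, pow_zero, one_smul]

/-- `Φ` is surjective. [folklore] -/
theorem Phi_surjective [IsLocalizedModule (Submonoid.powers b) ιb] :
    Function.Surjective (Phi ιb a b) := fun m => by
  obtain ⟨v, rfl⟩ := (toNθ ιb a b).surjective m
  exact ⟨PolynomialModule.single A 0 v, Phi_single_zero ιb a b v⟩

/-- An element of `Nb[T]` with no coefficients in degrees `≥ 1` is a constant. [folklore] -/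
theorem PolynomialModule.eq_single_zero_of_forall {q : PolynomialModule A Nb}
    (hq : ∀ k, 1 ≤ k → q.coeff k = 0) : q = PolynomialModule.single A 0 (q.coeff 0) := by
  apply PolynomialModule.coeff_injective
  ext k
  rw [PolynomialModule.coeff_single, Finsupp.single_apply]
  rcases Nat.eq_zero_or_pos k with rfl | hk
  · rw [if_pos rfl]
  · rw [if_neg (by omega), hq k hk]

/-- **`ker Φ = (bT - a) Nb[T]`**: the elements of degree `< d` killed by `Φ` are divisible by
`u = bT - a` — induction on `d`, peeling the top coefficient `v_d T^d` off with
`u • (b⁻¹ v_d) T^{d-1}`. [cite: Cesnavicius2021, proof of Thm. 3.13, (punch-1)] -/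
theorem mem_u_smul_top_of_Phi_eq_zero [IsLocalizedModule (Submonoid.powers b) ιb] (d : ℕ) :
    ∀ q : PolynomialModule A Nb, (∀ k, d ≤ k → q.coeff k = 0) → Phi ιb a b q = 0 →
      q ∈ (C b * X - C a : A[X]) • (⊤ : Submodule A[X] (PolynomialModule A Nb)) := by
  induction d with
  | zero =>
    intro q hq _
    have : q = 0 := PolynomialModule.coeff_injective (Finsupp.ext fun k => hq k (Nat.zero_le k))
    rw [this]
    exact Submodule.zero_mem _
  | succ d ih =>
    intro q hq hΦ
    cases d with
    | zero =>
      have hq0 := PolynomialModule.eq_single_zero_of_forall hq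
      rw [hq0, Phi_single_zero, LinearEquiv.map_eq_zero_iff] at hΦ
      rw [hq0, hΦ, PolynomialModule.single_zero]
      exact Submodule.zero_mem _
    | succ d =>
      -- top coefficient in degree `d + 1`; peel it off
      set v' : Nb := (↑(bUnit ιb b)⁻¹ : Module.End A Nb) (q.coeff (d + 1)) with hv'
      have hbv' : b • v' = q.coeff (d + 1) := b_smul_bUnit_inv ιb b _
      set w : PolynomialModule A Nb := PolynomialModule.single A d v' with hw
      have hcoeff : ∀ k, d + 1 ≤ k → (q - (C b * X - C a : A[X]) • w).coeff k = 0 := by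
        intro k hk
        obtain ⟨k, rfl⟩ : ∃ k', k = k' + 1 := ⟨k - 1, by omega⟩
        rw [PolynomialModule.coeff_sub, PolynomialModule.coeff_u_smul_succ, hw,
          PolynomialModule.coeff_single, Finsupp.single_apply,
          Finsupp.single_apply, if_neg (show d ≠ k + 1 by omega)]
        by_cases hkd : d = k
        · subst hkd
          rw [if_pos rfl, hbv', smul_zero, sub_zero, sub_self]
        · rw [if_neg hkd, smul_zero, smul_zero, sub_zero, sub_zero]
          exact hq (k + 1) (by omega)
      have hΦ' : Phi ιb a b (q - (C b * X - C a : A[X]) • w) = 0 := by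
        rw [map_sub, hΦ, LinearMap.map_smul, u_smul_Nθ, sub_zero]
      have hmem := ih _ hcoeff hΦ'
      have : q = (q - (C b * X - C a : A[X]) • w) + (C b * X - C a : A[X]) • w := by abel
      rw [this]
      exact Submodule.add_mem _ hmem (Submodule.smul_mem_pointwise_smul _ _ _ Submodule.mem_top)

/-- **`ker Φ = (bT - a) · Nb[T]`.** [cite: Cesnavicius2021, proof of Thm. 3.13, (punch-1)] -/
theorem ker_Phi [IsLocalizedModule (Submonoid.powers b) ιb] :
    LinearMap.ker (Phi ιb a b) =
      (C b * X - C a : A[X]) • (⊤ : Submodule A[X] (PolynomialModule A Nb)) := by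
  apply le_antisymm
  · intro q hq
    rw [LinearMap.mem_ker] at hq
    by_cases hq0 : q = 0
    · rw [hq0]
      exact Submodule.zero_mem _
    obtain ⟨m, -, hlt⟩ := PolynomialModule.exists_coeff_ne_zero_and_forall_lt hq0
    exact mem_u_smul_top_of_Phi_eq_zero ιb a b (m + 1) q (fun k hk => hlt k (by omega)) hq
  · intro q hq
    rw [Submodule.mem_smul_pointwise_iff_exists] at hq
    obtain ⟨q', -, rfl⟩ := hq
    rw [LinearMap.mem_ker, LinearMap.map_smul, u_smul_Nθ]

/-! ### `Nθ / P ≅ V[T]/(bT - a)V[T]`, `V = Nb/N` -/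

/-- The common kernel `(bT - a) Nb[T] + N[T] ⊆ Nb[T]`. [folklore] -/
def commonKer [IsLocalizedModule (Submonoid.powers b) ιb] : Submodule A[X] (PolynomialModule A Nb) :=
  (C b * X - C a : A[X]) • (⊤ : Submodule A[X] (PolynomialModule A Nb)) ⊔
    LinearMap.range (PolynomialModule.mapₗ A ιb)

/-- `Nb[T] → Nθ → Nθ/P`. [folklore] -/
def piP [IsLocalizedModule (Submonoid.powers b) ιb] :
    PolynomialModule A Nb →ₗ[A[X]] Nθ ιb a b ⧸ chartP ιb a b :=
  (chartP ιb a b).mkQ ∘ₗ Phi ιb a b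

/-- `Nb[T] → V[T] → V[T]/uV[T]`. [folklore] -/
def piV [IsLocalizedModule (Submonoid.powers b) ιb] :
    PolynomialModule A Nb →ₗ[A[X]]
      QuotSMulTop (C b * X - C a : A[X]) (PolynomialModule A (Nb ⧸ LinearMap.range ιb)) :=
  ((C b * X - C a : A[X]) • (⊤ : Submodule A[X] (PolynomialModule A (Nb ⧸ LinearMap.range ιb)))).mkQ ∘ₗ
    PolynomialModule.mapₗ A (LinearMap.range ιb).mkQ

/-- `Nb[T] → Nθ/P` is onto. [folklore] -/
theorem piP_surjective [IsLocalizedModule (Submonoid.powers b) ιb] :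
    Function.Surjective (piP ιb a b) :=
  (Submodule.mkQ_surjective _).comp (Phi_surjective ιb a b)

/-- `Nb[T] → V[T]/uV[T]` is onto. [folklore] -/
theorem piV_surjective [IsLocalizedModule (Submonoid.powers b) ιb] :
    Function.Surjective (piV ιb a b) :=
  (Submodule.mkQ_surjective _).comp (PolynomialModule.mapₗ_surjective (Submodule.mkQ_surjective _))

/-- `Φ(N[T]) ⊆ P`. [folklore] -/
theorem Phi_mapₗ_mem_chartP [IsLocalizedModule (Submonoid.powers b) ιb] (q : PolynomialModule A N) :
    Phi ιb a b (PolynomialModule.mapₗ A ιb q) ∈ chartP ιb a b := by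
  induction q using PolynomialModule.induction_linear with
  | zero => rw [map_zero, map_zero]; exact Submodule.zero_mem _
  | add q q' hq hq' => rw [map_add, map_add]; exact Submodule.add_mem _ hq hq'
  | single k x =>
    rw [PolynomialModule.mapₗ_single, Phi_single]
    exact Submodule.smul_mem _ _ (toNθ_mem_chartP ιb a b x)

/-- `P ⊆ Φ(N[T])`. [folklore] -/
theorem chartP_le_map [IsLocalizedModule (Submonoid.powers b) ιb] :
    chartP ιb a b ≤ (LinearMap.range (PolynomialModule.mapₗ A ιb)).map (Phi ιb a b) := by
  apply Submodule.span_le.mpr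
  rintro _ ⟨x, rfl⟩
  exact ⟨PolynomialModule.mapₗ A ιb (PolynomialModule.single A 0 x), ⟨_, rfl⟩, by
    rw [PolynomialModule.mapₗ_single, Phi_single_zero]; rfl⟩

/-- `ker (Nb[T] → Nθ/P) = (bT - a) Nb[T] + N[T]`. [cite: Cesnavicius2021, proof of Thm. 3.13] -/
theorem ker_piP [IsLocalizedModule (Submonoid.powers b) ιb] :
    LinearMap.ker (piP ιb a b) = commonKer ιb a b := by
  apply le_antisymm
  · intro q hq
    rw [LinearMap.mem_ker, piP, LinearMap.comp_apply, Submodule.mkQ_apply,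
      Submodule.Quotient.mk_eq_zero] at hq
    obtain ⟨q₀, hq₀, hq₀q⟩ := chartP_le_map ιb a b hq
    have hker : q - q₀ ∈ LinearMap.ker (Phi ιb a b) := by
      rw [LinearMap.mem_ker, map_sub, hq₀q, sub_self]
    rw [ker_Phi] at hker
    have : q = (q - q₀) + q₀ := by abel
    rw [this]
    exact Submodule.add_mem _ (Submodule.mem_sup_left hker) (Submodule.mem_sup_right hq₀)
  · apply sup_le
    · rw [← ker_Phi ιb a b]
      exact LinearMap.ker_le_ker_comp _ _
    · rintro _ ⟨q, rfl⟩
      rw [LinearMap.mem_ker, piP, LinearMap.comp_apply, Submodule.mkQ_apply,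
        Submodule.Quotient.mk_eq_zero]
      exact Phi_mapₗ_mem_chartP ιb a b q

/-- `ker (Nb[T] → V[T]/uV[T]) = (bT - a) Nb[T] + N[T]`. [cite: Cesnavicius2021, proof of Thm. 3.13] -/
theorem ker_piV [IsLocalizedModule (Submonoid.powers b) ιb] :
    LinearMap.ker (piV ιb a b) = commonKer ιb a b := by
  have hex := PolynomialModule.mapₗ_exact (A := A) (LinearMap.exact_map_mkQ_range ιb)
  apply le_antisymm
  · intro q hq
    rw [LinearMap.mem_ker, piV, LinearMap.comp_apply, Submodule.mkQ_apply,
      Submodule.Quotient.mk_eq_zero, Submodule.mem_smul_pointwise_iff_exists] at hq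
    obtain ⟨q'', -, hq''⟩ := hq
    obtain ⟨q', rfl⟩ := PolynomialModule.mapₗ_surjective (Submodule.mkQ_surjective _) q''
    have hdiff : q - (C b * X - C a : A[X]) • q' ∈ LinearMap.range (PolynomialModule.mapₗ A ιb) := by
      rw [← hex.linearMap_ker_eq, LinearMap.mem_ker, map_sub, LinearMap.map_smul, hq'', sub_self]
    have : q = (C b * X - C a : A[X]) • q' + (q - (C b * X - C a : A[X]) • q') := by abel
    rw [this]
    exact Submodule.add_mem _
      (Submodule.mem_sup_left (Submodule.smul_mem_pointwise_smul _ _ _ Submodule.mem_top))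
      (Submodule.mem_sup_right hdiff)
  · apply sup_le
    · intro q hq
      rw [Submodule.mem_smul_pointwise_iff_exists] at hq
      obtain ⟨q', -, rfl⟩ := hq
      rw [LinearMap.mem_ker, piV, LinearMap.comp_apply, Submodule.mkQ_apply,
        Submodule.Quotient.mk_eq_zero, LinearMap.map_smul]
      exact Submodule.smul_mem_pointwise_smul _ _ _ Submodule.mem_top
    · rintro _ ⟨q, rfl⟩
      rw [LinearMap.mem_ker, piV, LinearMap.comp_apply, hex.apply_apply_eq_zero, map_zero]

/-- **`Nθ / P ≅ V[T] / (bT - a) V[T]`**, `V = N[1/b]/N`, `A[T]`-linearly.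
[cite: Cesnavicius2021, proof of Thm. 3.13, (punch-1)] -/
def quotEquiv [IsLocalizedModule (Submonoid.powers b) ιb] :
    (Nθ ιb a b ⧸ chartP ιb a b) ≃ₗ[A[X]]
      QuotSMulTop (C b * X - C a : A[X]) (PolynomialModule A (Nb ⧸ LinearMap.range ιb)) :=
  (LinearMap.quotKerEquivOfSurjective (piP ιb a b) (piP_surjective ιb a b)).symm ≪≫ₗ
    Submodule.quotEquivOfEq _ _ ((ker_piP ιb a b).trans (ker_piV ιb a b).symm) ≪≫ₗ
      LinearMap.quotKerEquivOfSurjective (piV ιb a b) (piV_surjective ιb a b)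

end Chart

/-! ## The short exact sequence `0 → Γ → X/uX → (X/Γ)/u → 0` -/

section GammaSES

variable {V W : Type u} [AddCommGroup V] [Module A V] [AddCommGroup W] [Module A W]
  (φ : V →ₗ[A] W) (a b : A)

/-- `Γ = ker(φ[T]) ⊆ V[T]`. [folklore] -/
abbrev Gam : Submodule A[X] (PolynomialModule A V) := LinearMap.ker (PolynomialModule.mapₗ A φ)

/-- **`a` and `b` kill `Γ = (ker φ)[T]` if they kill `ker φ`, hence so does `u = bT - a`.**
[cite: Cesnavicius2021, proof of Thm. 3.13, Claim 3.13.2] -/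
theorem u_smul_eq_zero_of_mem_Gam (hker : ∀ v ∈ LinearMap.ker φ, a • v = 0 ∧ b • v = 0)
    {q : PolynomialModule A V} (hq : q ∈ Gam φ) : (C b * X - C a : A[X]) • q = 0 := by
  have hcoeff : ∀ q ∈ Gam φ, ∀ k, a • q.coeff k = 0 ∧ b • q.coeff k = 0 := by
    intro q hq k
    apply hker
    rw [LinearMap.mem_ker, ← PolynomialModule.coeff_mapₗ, LinearMap.mem_ker.mp hq]
    rfl
  have hX : (X : A[X]) • q ∈ Gam φ := Submodule.smul_mem _ _ hq
  apply PolynomialModule.coeff_injective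
  ext k
  rw [sub_smul, mul_smul, PolynomialModule.C_smul_eq, PolynomialModule.C_smul_eq,
    PolynomialModule.coeff_sub, PolynomialModule.coeff_smul_of_tower,
    PolynomialModule.coeff_smul_of_tower, (hcoeff _ hX k).2, (hcoeff _ hq k).1, sub_zero]
  rfl

/-- `Γ → X/uX`. [folklore] -/
def iotaGam : Gam φ →ₗ[A[X]] QuotSMulTop (C b * X - C a : A[X]) (PolynomialModule A V) :=
  ((C b * X - C a : A[X]) • (⊤ : Submodule A[X] (PolynomialModule A V))).mkQ ∘ₗ (Gam φ).subtype

/-- `X/uX → (X/Γ)/u(X/Γ)`. [folklore] -/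
def piGam : QuotSMulTop (C b * X - C a : A[X]) (PolynomialModule A V) →ₗ[A[X]]
    QuotSMulTop (C b * X - C a : A[X]) (PolynomialModule A V ⧸ Gam φ) :=
  QuotSMulTop.map (C b * X - C a : A[X]) (Gam φ).mkQ

/-- `X/uX → (X/Γ)/u` is onto. [folklore] -/
theorem piGam_surjective : Function.Surjective (piGam φ a b) :=
  QuotSMulTop.map_surjective _ (Submodule.mkQ_surjective _)

/-- Exactness at `X/uX`. [folklore] -/
theorem exact_iotaGam_piGam : Function.Exact (iotaGam φ a b) (piGam φ a b) := by
  have hcomp : (iotaGam φ a b : Gam φ → _) =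
      QuotSMulTop.map (C b * X - C a : A[X]) (Gam φ).subtype ∘
        ((C b * X - C a : A[X]) • (⊤ : Submodule A[X] (Gam φ))).mkQ := by
    funext γ
    rfl
  intro x
  rw [piGam, QuotSMulTop.map_exact (C b * X - C a : A[X]) (LinearMap.exact_subtype_mkQ (Gam φ))
    (Submodule.mkQ_surjective (Gam φ)) x, hcomp, (Submodule.mkQ_surjective _).range_comp]

/-- **`Γ ∩ uX = 0`**: `Γ → X/uX` is injective when `a` is injective on `W` and `a, b` kill
`ker φ`. [cite: Cesnavicius2021, proof of Thm. 3.13, (punch-2)] -/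
theorem iotaGam_injective (ha : Function.Injective fun w : W => a • w)
    (hker : ∀ v ∈ LinearMap.ker φ, a • v = 0 ∧ b • v = 0) :
    Function.Injective (iotaGam φ a b) := by
  rw [← LinearMap.ker_eq_bot, LinearMap.ker_eq_bot']
  intro γ hγ
  rw [iotaGam, LinearMap.comp_apply, Submodule.mkQ_apply, Submodule.Quotient.mk_eq_zero,
    Submodule.mem_smul_pointwise_iff_exists] at hγ
  obtain ⟨q, -, hq⟩ := hγ
  have hqΓ : q ∈ Gam φ := by
    have h1 : (C b * X - C a : A[X]) • PolynomialModule.mapₗ A φ q = 0 := by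
      rw [← LinearMap.map_smul, hq]
      exact LinearMap.mem_ker.mp γ.2
    have h2 : PolynomialModule.mapₗ A φ q = 0 :=
      PolynomialModule.isSMulRegular_u b ha
        (show (C b * X - C a : A[X]) • PolynomialModule.mapₗ A φ q =
          (C b * X - C a : A[X]) • (0 : PolynomialModule A W) by rw [h1, smul_zero])
    exact LinearMap.mem_ker.mpr h2
  apply Subtype.ext
  have hq' : (C b * X - C a : A[X]) • q = (γ : PolynomialModule A V) := hq
  change (γ : PolynomialModule A V) = 0
  rw [← hq']
  exact u_smul_eq_zero_of_mem_Gam φ a b hker hqΓ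

/-- `(X/Γ)/u(X/Γ) ≅ Z/uZ`, `Z = im(φ[T])`. [folklore] -/
def quotGamEquiv : QuotSMulTop (C b * X - C a : A[X]) (PolynomialModule A V ⧸ Gam φ) ≃ₗ[A[X]]
    QuotSMulTop (C b * X - C a : A[X]) (LinearMap.range (PolynomialModule.mapₗ A φ)) :=
  QuotSMulTop.congr (C b * X - C a : A[X]) (LinearMap.quotKerEquivRange (PolynomialModule.mapₗ A φ))

/-- `u` is a non-zero-divisor on `Z = im(φ[T]) ⊆ W[T]`. [folklore] -/
theorem isSMulRegular_u_range (ha : Function.Injective fun w : W => a • w) :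
    IsSMulRegular (LinearMap.range (PolynomialModule.mapₗ A φ)) (C b * X - C a : A[X]) := by
  intro z z' h
  apply Subtype.ext
  exact PolynomialModule.isSMulRegular_u b ha (congrArg Subtype.val h)

end GammaSES

/-! ## The step -/

section Step

variable {N Nb : Type u} [AddCommGroup N] [Module A N] [AddCommGroup Nb] [Module A Nb]
  (ιb : N →ₗ[A] Nb) (a b : A) {s : ℕ} {y : Fin s → A}

/-- `r ∈ √(y)` gives `C r ∈ √(f, y)` in `A[T]`. [folklore] -/
theorem C_mem_radical_span_cons {r : A} (hr : r ∈ (Ideal.span (Set.range y)).radical) (f : A[X]) :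
    (C r : A[X]) ∈ (Ideal.span (Set.range (Fin.cons f (yB A[X] y) : Fin (s + 1) → A[X]))).radical := by
  obtain ⟨k, hk⟩ := hr
  refine ⟨k, ?_⟩
  rw [← map_pow, Polynomial.C_eq_algebraMap]
  have hle : (Ideal.span (Set.range y)).map (algebraMap A A[X]) ≤
      Ideal.span (Set.range (Fin.cons f (yB A[X] y) : Fin (s + 1) → A[X])) := by
    rw [Ideal.map_span]
    apply Ideal.span_mono
    rintro _ ⟨_, ⟨i, rfl⟩, rfl⟩
    exact ⟨i.succ, by rw [Fin.cons_succ]⟩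
  exact hle (Ideal.mem_map_of_mem _ hk)

/-- **The inductive step of Kawasaki's theorem, chart form** (Česnavičius 2021, proof of
Thm. 3.13): with `φ : N[1/b]/N → W`, `a` bijective on `W`, `a, b ∈ √(y)` killing `ker φ`,
`Hʲ_{(y)}(ker φ) = 0` and `Hʲ_{(y)}(W / im φ) = 0` for `j < n`, and `f ∈ A[T]` monic, the chart
module `P = A[a/b] · N ⊆ N[1/b]` has `Hʲ_{(f, y)}(P) = 0` for `j < n + 2`.
[cite: Cesnavicius2021, Thm. 3.13, proof ((punch-1)–(punch-5), (bam-1)–(bam-4))]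
[cite: Kawasaki2000, Thm. 4.1] -/
theorem cechVanishBelow_chartP [IsLocalizedModule (Submonoid.powers b) ιb]
    (ha : a ∈ (Ideal.span (Set.range y)).radical) (hb : b ∈ (Ideal.span (Set.range y)).radical)
    {W : Type u} [AddCommGroup W] [Module A W] (hW : Function.Bijective fun w : W => a • w)
    (φ : (Nb ⧸ LinearMap.range ιb) →ₗ[A] W)
    (hker : ∀ v ∈ LinearMap.ker φ, a • v = 0 ∧ b • v = 0) {n : ℕ}
    (hE1 : CechVanishBelow y (LinearMap.ker φ) n)
    (hE2 : CechVanishBelow y (W ⧸ LinearMap.range φ) n) {f : A[X]} (hf : f.Monic) :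
    CechVanishBelow (Fin.cons f (yB A[X] y) : Fin (s + 1) → A[X]) (chartP ιb a b) (n + 2) := by
  have hCa := C_mem_radical_span_cons ha f
  have hCb := C_mem_radical_span_cons hb f
  -- `H(Nθ) = 0` in all degrees, so `P` is controlled by `Nθ/P ≅ X/uX`
  have hNθ : ∀ k, CechVanishBelow (Fin.cons f (yB A[X] y) : Fin (s + 1) → A[X]) (Nθ ιb a b) k :=
    CechVanishBelow.of_smul_bijective hCb (bijective_C_b_smul_Nθ ιb a b)
  refine CechVanishBelow.left_of_forall (chartP ιb a b).injective_subtype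
    (Submodule.mkQ_surjective _) (LinearMap.exact_subtype_mkQ (chartP ιb a b)) hNθ ?_
  refine CechVanishBelow.of_equiv (quotEquiv ιb a b).symm ?_
  -- `X/uX` from `Γ` and `(X/Γ)/u ≅ Z/uZ`
  refine CechVanishBelow.mid (iotaGam_injective φ a b hW.1 hker) (piGam_surjective φ a b)
    (exact_iotaGam_piGam φ a b) ?_ ?_
  · -- `Γ ≅ (ker φ)[T]`: polynomial shift
    exact (hE1.polynomialModule hf).of_equiv (PolynomialModule.kerEquiv φ)
  · refine CechVanishBelow.of_equiv (quotGamEquiv φ a b).symm ?_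
    refine CechVanishBelow.quotSMulTop (isSMulRegular_u_range φ a b hW.1) ?_
    -- `Z` from `0 → Z → Y → Y/Z → 0`, `H(Y) = 0`, `Y/Z ≅ (W/im φ)[T]`
    have hY : ∀ k, CechVanishBelow (Fin.cons f (yB A[X] y) : Fin (s + 1) → A[X])
        (PolynomialModule A W) k :=
      CechVanishBelow.of_smul_bijective hCa (PolynomialModule.bijective_C_smul hW)
    refine CechVanishBelow.left_of_forall
      (LinearMap.range (PolynomialModule.mapₗ A φ)).injective_subtype (Submodule.mkQ_surjective _)
      (LinearMap.exact_subtype_mkQ _) hY ?_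
    exact (hE2.polynomialModule hf).of_equiv (PolynomialModule.cokerEquiv φ).symm

/-! ### Transport to a model of `N[1/b]` inside an `A[T]`-module -/

variable {Ω' : Type u} [AddCommGroup Ω'] [Module A Ω'] [Module A[X] Ω'] [IsScalarTower A A[X] Ω']

omit [IsScalarTower A A[X] Ω'] in
/-- `κ(θ v) = T • κ(v)` from `T • κ(b v) = κ(a v)`. [folklore] -/
theorem kappa_theta [IsLocalizedModule (Submonoid.powers b) ιb] (κ : Nb →ₗ[A] Ω')
    (hκX : ∀ v : Nb, (X : A[X]) • κ (b • v) = κ (a • v)) (v : Nb) :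
    κ (theta ιb a b v) = (X : A[X]) • κ v := by
  set v' := (↑(bUnit ιb b)⁻¹ : Module.End A Nb) v with hv'
  have hv : v = b • v' := (b_smul_bUnit_inv ιb b v).symm
  rw [hv, theta_b_smul, hκX]

/-- The `A[T]`-linear extension `Nθ → Ω'` of `κ`. [folklore] -/
def kappaX [IsLocalizedModule (Submonoid.powers b) ιb] (κ : Nb →ₗ[A] Ω')
    (hκX : ∀ v : Nb, (X : A[X]) • κ (b • v) = κ (a • v)) : Nθ ιb a b →ₗ[A[X]] Ω' :=
  LinearMap.ofAEval (theta ιb a b) κ (kappa_theta ιb a b κ hκX)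

/-- `κ̃` extends `κ`. [folklore] -/
theorem kappaX_toNθ [IsLocalizedModule (Submonoid.powers b) ιb] (κ : Nb →ₗ[A] Ω')
    (hκX : ∀ v : Nb, (X : A[X]) • κ (b • v) = κ (a • v)) (v : Nb) :
    kappaX ιb a b κ hκX (toNθ ιb a b v) = κ v := rfl

/-- `κ̃` is injective if `κ` is. [folklore] -/
theorem kappaX_injective [IsLocalizedModule (Submonoid.powers b) ιb] (κ : Nb →ₗ[A] Ω')
    (hκ : Function.Injective κ) (hκX : ∀ v : Nb, (X : A[X]) • κ (b • v) = κ (a • v)) :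
    Function.Injective (kappaX ιb a b κ hκX) := fun m m' h => by
  obtain ⟨v, rfl⟩ := (toNθ ιb a b).surjective m
  obtain ⟨v', rfl⟩ := (toNθ ιb a b).surjective m'
  rw [kappaX_toNθ, kappaX_toNθ] at h
  rw [hκ h]

/-- `κ̃(P) = A[T] · κ(N)`. [folklore] -/
theorem map_kappaX_chartP [IsLocalizedModule (Submonoid.powers b) ιb] (κ : Nb →ₗ[A] Ω')
    (hκX : ∀ v : Nb, (X : A[X]) • κ (b • v) = κ (a • v)) :
    (chartP ιb a b).map (kappaX ιb a b κ hκX) = Submodule.span A[X] (Set.range (κ ∘ ιb)) := by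
  rw [chartP, Submodule.map_span, ← Set.range_comp]
  rfl

/-- **The step, transported**: for any `A[T]`-module `Ω'` and any injective `A`-linear
`κ : N[1/b] → Ω'` with `T • κ(b v) = κ(a v)` (i.e. `T` acts as `a/b` on the image), the
`A[T]`-submodule `A[T] · κ(N) ⊆ Ω'` has `Hʲ_{(f, y)} = 0` for `j < n + 2` under the hypotheses of
`cechVanishBelow_chartP`. In the application `Ω' = M[1/gb]` over the next chart ring `A[a/b]` and
`A[T] · κ(N)` is the next chart module. [cite: Cesnavicius2021, Thm. 3.13, proof]
[cite: Kawasaki2000, Thm. 4.1] -/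
theorem cechVanishBelow_span_of_chart [IsLocalizedModule (Submonoid.powers b) ιb]
    (ha : a ∈ (Ideal.span (Set.range y)).radical) (hb : b ∈ (Ideal.span (Set.range y)).radical)
    {W : Type u} [AddCommGroup W] [Module A W] (hW : Function.Bijective fun w : W => a • w)
    (φ : (Nb ⧸ LinearMap.range ιb) →ₗ[A] W)
    (hker : ∀ v ∈ LinearMap.ker φ, a • v = 0 ∧ b • v = 0) {n : ℕ}
    (hE1 : CechVanishBelow y (LinearMap.ker φ) n)
    (hE2 : CechVanishBelow y (W ⧸ LinearMap.range φ) n) {f : A[X]} (hf : f.Monic)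
    (κ : Nb →ₗ[A] Ω') (hκ : Function.Injective κ)
    (hκX : ∀ v : Nb, (X : A[X]) • κ (b • v) = κ (a • v)) :
    CechVanishBelow (Fin.cons f (yB A[X] y) : Fin (s + 1) → A[X])
      (Submodule.span A[X] (Set.range (κ ∘ ιb))) (n + 2) := by
  have h := cechVanishBelow_chartP ιb a b ha hb hW φ hker hE1 hE2 hf
  rw [← map_kappaX_chartP ιb a b κ hκX]
  exact h.of_equiv (Submodule.equivMapOfInjective _ (kappaX_injective ιb a b κ hκ hκX) _)

end Step

end Literature.RingTheory.LocalCohomology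

end
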